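import Mathlib.Data.Rat.Defs
import Mathlib.Tactic.Linarith
import Mathlib.Tactic.NormNum
import Mathlib.Tactic.Ring
import Mathlib.Tactic.LinearCombination
import Mathlib.Tactic.Positivity
import HarnessLib

/-!
# The (0,1) cell of the ι-window, XXI-D: the product ground `B₁ × B₂`, VIII (fourth file) — the RANK-TWO TRANSFORM LINES (THEOREM T2 / FT of
# report [XXI] §6): the classes `v_K = (2K²+2K−1, −(2K+1), 2) = Φ(T^K(2,1,−1))`, their universal frames, Euler data, the equal-slope arithmetic,
# and the new atlas counts

Family `hodge`, b2b cell `hweil` (helper of item stmt-HodgeConjecture-2524). Fourth companion (`pg8d_*`) of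
`WeilTypeLadderH2ProductGroundEight{,B,C}.lean` (prover 1 gen 33). Report `run/shared/lean/b2b/hodge-weil/b2b-hweil-pv1-g33/H2-ZERO-ONE-21.md`
([XXI] §6). HONEST FRAMING: census results inside the ladder's H2 test ((0,1) cell) on the SPECIAL fourfold `X₀ = B₁ × B₂`; emptiness /
non-isolation of a family there is a census line and nothing more. No case of the Hodge conjecture is proved; nothing here is a rung; no statement of
[Markman 2025] / [Perry 2026] / [EdGFS 2025] is used. Every head is the elementary arithmetic SHADOW of a named step of the report; the geometry
(Mukai's Fourier functor, Yoshioka's Lemma 4.1, the cell's LEMMA D / U / JD / R2 / MR) is quoted print and certified items.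

Conventions as in the companions: classes `(r, c, s)`, Mukai pairing `⟨(r,c,s),(r',c',s')⟩ = 2cc' − rs' − r's`, `χ = −⟨·,·⟩`, norm `c² − rs`,
slope `2c/r`; `T(r,c,s) = (r, c+r, s+2c+r)`, `Φ(r,c,s) = (s, −c, r)`; square classes `[(βX+δY)²] = (β², βδ, δ²)`, `[2λλ'] = (2ββ', βδ'+β'δ, 2δδ')`.

* `pg8d_t2_classes` — `T^K(2,1,−1) = (2, 2K+1, 2K²+2K−1)` (one step), `Φ` of it is `v_K`, norm `3`, `(2K+1)² − 2(2K²+2K−1) = 3` (so `gcd(rk, deg) ∣ 3`);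
  the universal frames: `3[(K+1, −1)²] − [(K+2, −1)²] = v_K` (reading `P′(K) = (K+1, 2K+3)`, chamber `(K+2, K+1)`, det `−1`, a bottom) and
  `3[(K, 1)²] − [(K−1, 1)²] = v_K^∨` (reading `P(K) = (K, 2K−1)`, chamber `(K−1, K)`, det `−1`, a bottom); the hull class `v_K + (1,0,0)` of the
  NL-derived members has norm `1` (the unit class of LEMMA D₁ with `k = K`).
* `pg8d_t2_euler` — in both frames `s(w₂) = 10`, `s(w₁) = 6` (so `χ(A′, w₂) = s(w₂) − 6 = 4` and `χ(Q₁, P_w) = s(w₁) = 6`), `χ((1,0,0),(r,c,s)) = s`,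
  and the slope comparisons `μ(A′) = −(2K+1)/(K(K+1)) < μ(u₁) = −2/(K+1)`, `μ(u₀) = −2/(K+2) < 0` used for the EMPTY bounds `hom ≥ 4`, `ext¹ ≥ 6`.
* `pg8d_t2_equal_slope` — the equal-slope exclusions of THEOREM T2 when `3 ∣ gcd` (`K ≡ 1 mod 3`): a μ-stable piece of class
  `(j(2K²+2K−1)/3, −j(2K+1)/3, l)` is impossible: `j = 1`: Bogomolov fails for `K ≥ 2`; `j = 2`, `l ≥ 2`: Bogomolov fails; `j = 2`, `l = 1`: the
  rank-one image in the μ-stable rank-two source would have `3d = 2(2K+1)` and `d ≤ K`, absurd.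
* `pg8d_t2_it` — degree arithmetic of the IT₀ statements: `2K+1 ≥ 5 > 4 = 2g` (global generation on the theta divisor), `deg ξ₁ = 3 − 2 = 1`,
  `deg ξ₁(KΘ) = 1 + 2K`.
* `pg8d_t2_counts` — the atlas of [XXI] §7: `18 + 16 + 4 = 38` new readings, `112 + 38 = 150` settled, `443 − 150 = 293` open, `325 − 34 = 291` open
  bottoms, `92 + 34 = 126`, `18 + 4 = 22`, Ψ-depth census `220 + 71 = 291`; `gcd(39, 9) = 3`, `gcd(23, 7) = 1`.
-/

-- mandated namespace `Summit.HodgeConjecture.HodgeConjecture.…` (Problem = Summit) trips `linter.dupNamespace`; the lakefile disables it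
-- tree-wide (weak option), restated here so stand-alone elaboration is warning-free too.
set_option linter.dupNamespace false

namespace Summit.HodgeConjecture.HodgeConjecture.WeilTypeLadder

section ProductGroundEightD

/-- **The rank-two transform classes and their universal frames (report §6.1, THEOREM T2 / FT).** One `T`-step
`T(2, 2K+1, 2K²+2K−1) = (2, 2(K+1)+1, 2(K+1)²+2(K+1)−1)` (so `T^K(2,1,−1) = (2, 2K+1, 2K²+2K−1)` by induction from `K = 0`); `Φ` gives
`v_K = (2K²+2K−1, −(2K+1), 2)`, norm `3`; `(2K+1)² − 2(2K²+2K−1) = 3`; the frame identities `3((K+1)², −(K+1), 1) − ((K+2)², −(K+2), 1) = v_K`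
with `det((K+2,−1),(K+1,−1)) = −1`, chamber coordinates `(b−a, a) = (K+2, K+1)` for `(a,b) = (K+1, 2K+3)`, bottom test `2(K+2) < 3(K+1)` for `K ≥ 2`;
and `3(K², K, 1) − ((K−1)², K−1, 1) = v_K^∨ = (2K²+2K−1, 2K+1, 2)` with `det((K−1,1),(K,1)) = −1`, chamber `(K−1, K)` for `(a,b) = (K, 2K−1)`, bottom
test `2(K−1) < 3K`; the hull class `v_K + (1,0,0) = (2K²+2K, −(2K+1), 2)` has norm `1`. [shadow: `ring` / `nlinarith`] -/
theorem pg8d_t2_classes (K : ℤ) :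
    (((2 : ℤ) = 2 ∧ (2 * K + 1) + 2 = 2 * (K + 1) + 1 ∧ (2 * K ^ 2 + 2 * K - 1) + 2 * (2 * K + 1) + 2 = 2 * (K + 1) ^ 2 + 2 * (K + 1) - 1)) ∧
    ((2 * K + 1) ^ 2 - (2 * K ^ 2 + 2 * K - 1) * 2 = 3) ∧
    (((3 * (K + 1) ^ 2 - (K + 2) ^ 2, 3 * (-(K + 1)) - (-(K + 2)), (3 : ℤ) * 1 - 1) = (2 * K ^ 2 + 2 * K - 1, -(2 * K + 1), 2)) ∧
     ((K + 2) * (-1) - (K + 1) * (-1) = -1) ∧ ((2 * K + 3) - (K + 1) = K + 2) ∧ (2 ≤ K → 2 * (K + 2) < 3 * (K + 1))) ∧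
    (((3 * K ^ 2 - (K - 1) ^ 2, 3 * K - (K - 1), (3 : ℤ) * 1 - 1) = (2 * K ^ 2 + 2 * K - 1, 2 * K + 1, 2)) ∧
     ((K - 1) * 1 - K * 1 = -1) ∧ ((2 * K - 1) - K = K - 1) ∧ (2 * (K - 1) < 3 * K ↔ -2 < K)) ∧
    ((-(2 * K + 1)) ^ 2 - (2 * K ^ 2 + 2 * K - 1 + 1) * 2 = 1) := by
  refine ⟨⟨rfl, by ring, by ring⟩, by ring, ⟨?_, by ring, by ring, fun h => by linarith⟩, ⟨?_, by ring, by ring, ?_⟩, by ring⟩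
  · ext <;> simp <;> ring
  · ext <;> simp <;> ring
  · constructor <;> intro h <;> linarith

/-- **Euler data of the two frames (report §6.3, THEOREM FT).** With `d₀ = d₁ = δ ∈ {±1}` (both frames have equal `d`'s after `T`-normalisation:
`((K+2,−1),(K+1,−1))` and `((K−1,1),(K,1))`), the `χ`-components are `s(u_i) = δ² = 1`, `s(n) = 2δ² = 2`, hence `s(w₂) = s(6u₁ + 2n) = 10` and
`s(w₁) = s(2u₀ + 2n) = 6`; `χ((1,0,0),(r,c,s)) = −(0 − s − 0) = s`; so for the NL-derived members `R = ker(A′ ↠ P_w)`, `v(A′) = v_K + (1,0,0)`: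
`χ(A′, w₂) = χ(v_K, w₂) + s(w₂) = −6 + 10 = 4` and `χ(Q₁, P_w) = s(w₁) = 6`. Slopes (cleared denominators, `K ≥ 1`): `μ(A′) = −2(2K+1)/(2K²+2K) <
−2/(K+1) = μ(u₁)` iff `2K(K+1) < (2K+1)(K+1)`, and `μ(u₀) = −2/(K+2) < 0`. Along the ray the `s`-component of `w₂^{(j)}` is `6d₁'² + 4d₀'d₁'` with
`(d₀',d₁') = (2d₀+3d₁, d₀+2d₁)`: at `j = 1`, `6·9 + 4·15 = 114`, `114 − 6 = 108`. [shadow: `ring` / `nlinarith` / `norm_num`] -/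
theorem pg8d_t2_euler (K δ r c s : ℤ) (hδ : δ ^ 2 = 1) :
    (6 * δ ^ 2 + 2 * (2 * δ * δ) = 10 ∧ 2 * δ ^ 2 + 2 * (2 * δ * δ) = 6) ∧
    (-(2 * 0 * c - 1 * s - r * 0) = s) ∧ ((-6 : ℤ) + 10 = 4) ∧
    (1 ≤ K → 2 * K * (K + 1) < (2 * K + 1) * (K + 1) ∧ 0 < K + 2) ∧
    ((2 * (-1) + 3 * (-1) = (-5 : ℤ)) ∧ ((-1) + 2 * (-1) = (-3 : ℤ)) ∧ (6 * (-3) ^ 2 + 4 * ((-5) * (-3)) = (114 : ℤ)) ∧ ((114 : ℤ) - 6 = 108)) := by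
  refine ⟨⟨by nlinarith, by nlinarith⟩, by ring, by norm_num, fun hK => ⟨by nlinarith, by linarith⟩, by norm_num⟩

/-- **The equal-slope exclusions of THEOREM T2 (report §6.2, STEP 2).** `F = Φ(E′(KΘ))` has rank `r = 2K²+2K−1` and `c₁ = −(2K+1)θ̂`;
`(2K+1)² − 2r = 3`, so `gcd(r, 2K+1) ∣ 3` and equality of slopes for a proper saturated `N ⊂ F` forces `3 ∣ r`, `v(N) = (j·r/3, −j(2K+1)/3, l)` with
`j ∈ {1,2}`, `l = χ(N) ≥ 1` (LEMMA D (iii)). Writing `r = 3ρ`, `2K+1 = 3d₁` (integers): Bogomolov for the μ-stable (simple) `N` reads `j·ρ·l ≤ (j·d₁)²`,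
i.e. `ρ l ≤ j d₁²`; and if `l = 1` the rank-one image of `Φ̂²(N)` in the μ-stable rank-two `E′(KΘ)` (slope `2K+1 = 3d₁`) has slope `2·j·d₁ < 3d₁`,
i.e. `j = 1`. The lemma: for `K ≥ 2` (so `ρ ≥ 3`... precisely `3ρ = 2K²+2K−1`, `3d₁ = 2K+1`) there is no `(j, l)` with `j ∈ {1,2}`, `l ≥ 1`,
`ρ l ≤ j d₁²` and (`l = 1 → 2j < 3`). [shadow: `nlinarith`] -/
theorem pg8d_t2_equal_slope (K ρ d1 j l : ℤ) (hK : 2 ≤ K) (hρ : 3 * ρ = 2 * K ^ 2 + 2 * K - 1) (hd : 3 * d1 = 2 * K + 1)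
    (hj : j = 1 ∨ j = 2) (hl : 1 ≤ l) (hbog : ρ * l ≤ j * d1 ^ 2) (hJ : l = 1 → 2 * j < 3) : False := by
  -- 9ρ = 3(2K²+2K−1) and 9d1² = (2K+1)² = 4K²+4K+1, so 9ρ·l ≤ 9j d1² reads 3(2K²+2K−1) l ≤ j (4K²+4K+1)
  have h9 : 3 * (2 * K ^ 2 + 2 * K - 1) * l ≤ j * (2 * K + 1) ^ 2 := by
    have h1 : 9 * (ρ * l) ≤ 9 * (j * d1 ^ 2) := by linarith
    have h2 : 9 * (ρ * l) = 3 * (2 * K ^ 2 + 2 * K - 1) * l := by rw [← hρ]; ring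
    have h3 : 9 * (j * d1 ^ 2) = j * (3 * d1) ^ 2 := by ring
    rw [h2, h3, hd] at h1; exact h1
  rcases hj with rfl | rfl
  · -- j = 1: 3(2K²+2K−1) l ≤ 4K²+4K+1 with l ≥ 1, K ≥ 2: impossible
    nlinarith
  · -- j = 2
    rcases eq_or_lt_of_le hl with hl1 | hl2
    · -- l = 1: hJ gives 4 < 3
      have := hJ hl1.symm; omega
    · -- l ≥ 2: 6(2K²+2K−1) ≤ 3(…)l ≤ 2(4K²+4K+1): impossible for K ≥ 2
      nlinarith

/-- **Degree arithmetic of the IT₀ statements (report §6.2, STEP 1).** On the genus-2 theta divisor (`2g − 2 = 2`, `2g = 4`): the NL members'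
hull quotient `ξ₁` has degree `3 − 2 = 1` (ξ₃ twisted down once), and `ξ₁(KΘ)` has degree `1 + 2K ≥ 5 > 4` for `K ≥ 2` (globally generated and
IT₀), `deg > 2` already for `K ≥ 1`; the twist `K − 1 ≥ 1` of the line bundle `P_β` in the LF cokernel presentation kills `H²`.
[shadow: `linarith`] -/
theorem pg8d_t2_it (K : ℤ) (hK : 2 ≤ K) :
    ((3 : ℤ) - 2 = 1) ∧ (4 < 1 + 2 * K) ∧ (2 < 1 + 2 * K) ∧ (1 ≤ K - 1) ∧ ((2 : ℤ) * 2 - 2 = 2) := by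
  refine ⟨by norm_num, by linarith, by linarith, by linarith, by norm_num⟩

/-- **Atlas counts after THEOREM FT (report §7).** New readings at height `≤ 40`: `18` bottoms `P(K) = (K, 2K−1)`, `3 ≤ K ≤ 20`, `16` bottoms
`P′(K) = (K+1, 2K+3)`, `3 ≤ K ≤ 18`, and `4` higher members `(8,21), (11,29), (14,37), (13,35)`: `18 + 16 + 4 = 38`; settled `112 + 38 = 150`, open
`443 − 150 = 293`; bottoms: settled `92 + 34 = 126`, open `325 − 34 = 291`; higher members of settled rays `18 + 4 = 22`, of open rays `6 − 4 = 2`;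
`126 + 22 + 2 + 291 + 2 = 443`; Ψ-depth census of the `291` open bottoms over the enlarged classified set: `220 + 71 = 291`; the coprimality
examples `gcd(23, 7) = 1`, `gcd(39, 9) = 3`, `gcd(59, 11) = 1`. [shadow: `norm_num` / `decide`] -/
theorem pg8d_t2_counts :
    (18 + 16 + 4 = (38 : ℕ)) ∧ (112 + 38 = (150 : ℕ)) ∧ (443 - 150 = (293 : ℕ)) ∧ (92 + 34 = (126 : ℕ)) ∧ (325 - 34 = (291 : ℕ)) ∧
    (18 + 4 = (22 : ℕ)) ∧ (6 - 4 = (2 : ℕ)) ∧ (126 + 22 + 2 + 291 + 2 = (443 : ℕ)) ∧ (220 + 71 = (291 : ℕ)) ∧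
    (Nat.gcd 23 7 = 1) ∧ (Nat.gcd 39 9 = 3) ∧ (Nat.gcd 59 11 = 1) := by
  refine ⟨by norm_num, by norm_num, by norm_num, by norm_num, by norm_num, by norm_num, by norm_num, by norm_num, by norm_num,
    by decide, by decide, by decide⟩

end ProductGroundEightD

end Summit.HodgeConjecture.HodgeConjecture.WeilTypeLadder
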